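import Summits.BirchSwinnertonDyer.BirchSwinnertonDyer.Theorems.KimAtThreeFineKatoSemiLocalAssembly
import Summits.BirchSwinnertonDyer.BirchSwinnertonDyer.Theorems.KimAtThreeFineKatoLevelCompatFactor
import HarnessLib

/-!
# Crux `KatoKuriharaPortThreeShared` (stmt-BirchSwinnertonDyer-19560): the per-factor COMPAT clause of the
# per-factor defined-Kato package `hKloc` DERIVED from three definitional properties (DEF_w)/(RES_w)/(LAT_w)
# of a per-factor dual exponential `φ_w = exp*_w` — w2-acc5 g4's Galois-side theorem FOLDED into the
# LEAD's package: `hKdef ⟹ hKloc ⟹ stub_fineKato`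
# (cell `bsd-addord`, seat kim3 gen 14 = the crux's LEAD; route W2 `KimAtThreeKolyvagin`; `--supports 19560`)

HONEST FRAMING.  TOOL theorems only (no definition, no named fact, no `sorry`); closes nothing; nothing is
booked; BSD is not proved by any of this.  `hKdef` is a DISPLAYED hypothesis.

WHAT.  This seat's `KimAtThreeFineKatoSemiLocalAssembly.fineKato_of_perFactorKatoPackage` (p496573) reduced
the registered stub `stub_fineKato` (⟨C1⟩) to the PER-FACTOR package `hKloc`, whose clause (f) is the
per-factor COMPAT implication «`res κ₀ = Ψ′ y`, `loc_{v₃} κ₀ = π_{j+1,*} h` ⟹ `∀ w, Ψ(exp*_ω(h) ⊗ 1 −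
3⁰·Λ_{0,r}(y))_w ∈ 3^{j+1}·Mʷ`».  Seat w2-acc5 gen 4 proved the Galois side of exactly that implication
(`KimAtThreeFineKatoLevelCompatFactor.exists_sub_eq_zsmul_apply_of_factorDef`, p496279) at ONE field
`F ⊇ ℚ_v` whose tower restriction lands in the level, for ANY additive `φ_F` on `H¹(Γ_F, T₃W)` (tower
action), from two DEFINITIONAL properties of a defined `exp*`: (DEF_w) `Λ`'s `w`-component is
`φ_F ∘ loc_w` read on cocycles, (RES_w) `φ_F ∘ res_{F/ℚ_v} = e`.  THIS FILE folds that theorem into the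
LEAD's package at `F := L_w = ℚ(ζ_m)_w` (w2-acc4's completions, the factors of `Ψ`):

* §1 `absGaloisRestrictTower_adicCompletion_mem_cycSubgroup` — the level hypothesis `hU` DISCHARGED for
  `F = L_w`: `L_w ∋ ζ_m` (the image of `IsCyclotomicExtension.zeta`), so the tower restriction
  `Γ_{L_w} → Γ_{ℚ_v} → Γ_ℚ` lands in `cycSubgroup 3 0 r` (w2-acc5 `absGaloisRestrictTower_mem_cycSubgroup`;
  the `ℚ_v`-algebra structure on `L_w` is the FLT packet's on `v₀.adicCompletion ℚ` — which IS
  `Place.Completion (Sum.inr v₀)` by `rfl` —, `v₀ = primesEquiv.symm 3` the base place of `Ψ`).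
* §2 **`perFactorKatoPackage_of_perFactorDefined : hKdef → hKloc`**, where `hKdef` is `hKloc` with clause (f)
  REPLACED by: a displayed per-factor additive `φ_w : H¹(Γ_{L_w}, T₃W|tower) →+ L_w` (intended `exp*_w` in
  the Néron coordinate) with **(LAT_w)** `range φ_w ⊆ Mʷ`, **(RES_w)** `φ_w(res_{L_w/ℚ_v} h) = e₃(φ h)` in
  `L_w` (restriction functoriality of `exp*`, `dualExp_map`-type), **(DEF_w)** `Ψ(Λ_{0,r} [φ″])_w = φ_w[ψT]`
  for every level cocycle `φ″` and its tower cocycle `ψT` (Kato-v2's DEFINITION `Λ_{0,r} := Ψ⁻¹(exp*_w ∘ loc_w)_w`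
  read on cocycles) — and with the row's place FIXED to `v₀` (the `∀ v₃ ∋ 3` binder of `hKloc` is
  discharged by `v₃ = v₀`, `primesEquiv_eq_of_natCast_mem`).  Per factor: acc5's theorem gives
  `e₃(φ h) − Ψ(Λ y)_w = 3^{j+1} • φ_w y′`, and `μ_w := φ_w y′ ∈ Mʷ` by (LAT_w); the bookkeeping
  `Ψ(φ h ⊗ 1 − 3⁰•Λ y)_w = e₃(φ h) − Ψ(Λ y)_w` is `hΨ` + `pow_zero`/`one_smul`.
* (sibling file `KimAtThreeFineKatoPerFactorDefinedCrux`, route cone) `fineKato_of_perFactorDefinedPackage :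
  hKdef → ⟨stub_fineKato signature VERBATIM⟩` (§2 ∘ p496573) and the crux BY NAME from `hKdef`.

READING FOR THE RESIDUAL OF RECORD.  **19560 ⟸ ⟨C1⟩ ⟸ hKloc ⟸ hKdef**; `hKdef` displays, per Kato-stratum row
at the place `v₀`: (a) R-κ; (b)(c) `hker`/`hdual` for `φ = exp*_ω` on `H¹(ℚ₃, T)` (cite items); per `(j, r)`,
`Ψ` and factor `w ∣ 3`: (d) the log-lattice `Λ₀ʷ ⊆ 𝒪_w ∋ 0` with ONE unit-trace point (w2-kport + w2-acc4's
`hres`), (e) the `exp*`-lattice `Mʷ`, `Tr(Mʷ·Λ₀ʷ) ⊆ ℤ₃` ([BK90] 3.8 + duality over `L_w`), and the defined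
`exp*_w` itself as `φ_w` with (LAT_w)/(RES_w)/(DEF_w) (= Kato-v2 + restriction functoriality); (g) `ZetaBody`.
NO compat implication, NO tensor-algebra statement, NO rider, NO `Λfin` is displayed.

NOT here: any `exp*`, any logarithm, (C3a)/(C3b) for the defined `Λ` (w2-acc5 `locTower_eq_zero_of_forall_primesAbove`
is the (C3b) half), any residue-field argument; `p = 3`, tame levels, `t = 0` (the crux's binders).

References: K. Kato, Astérisque 295 (2004) §9.4, Thm. 9.7 [Kato2004Asterisque]; S. Bloch, K. Kato (1990) §3
Prop. 3.8, Ex. 3.11 [BlochKato1990]; C.-H. Kim, AJM 148 (2026) §3.4.1 and the proof of Thm. 3.13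
[Kim2022StructureSelmer]; K. Rubin, *Euler Systems* (2000) Ch. III §2.1 [Rubin2000]; J. W. S. Cassels,
A. Fröhlich (1967) Ch. II §10 (10.2) [CasselsFrohlichANT1967]; kim3 memo KIM3-W2-C1c-SEMILOCAL-g14 §2;
w2-acc5 g4 STATUS 2026-08-27T04:25Z/04:27Z (DEF)/(RES)/(LAT)).
-/

noncomputable section

-- the cell's Theorems namespace `Summit.BirchSwinnertonDyer.BirchSwinnertonDyer.…` repeats the summit name by design (D-0017)
set_option linter.dupNamespace false

open scoped Classical NumberField TensorProduct ContRepresentation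
open Field NumberField IsDedekindDomain
open WeierstrassCurve Literature.NumberTheory.EllipticCurves Literature.NumberTheory.GaloisRepresentations
  Literature.NumberTheory.GaloisRepresentations.DiscreteGaloisModule Literature.NumberTheory.GaloisCohomology
open Literature.NumberTheory.EllipticCurves.ModularForms Literature.NumberTheory.EllipticCurves.Rank1Residual
open Literature.NumberTheory.EllipticCurves.Kato2004 Literature.NumberTheory.EllipticCurves.Kato2004.EulerSystemValues
open Literature.NumberTheory.AdelicBaseChange
open Summit.BirchSwinnertonDyer.Rank1Residual.GaloisImage
open Summit.BirchSwinnertonDyer.Rank1Residual.Additive.LocalLog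
open Summit.BirchSwinnertonDyer.BirchSwinnertonDyer.Theorems
open Summit.BirchSwinnertonDyer.BirchSwinnertonDyer.Theorems.KimAtThreeFineKatoLevelCompat
open Summit.BirchSwinnertonDyer.BirchSwinnertonDyer.Theorems.KimAtThreeFineKatoLevelCompatFactor

namespace Summit.BirchSwinnertonDyer.BirchSwinnertonDyer.Theorems.KimAtThreeFineKatoPerFactorDefined

/-! ### §1. The level hypothesis `hU` for the completions `L_w = ℚ(ζ_m)_w` -/

set_option backward.isDefEq.respectTransparency false in
/-- **The tower restriction `Γ_{L_w} → Γ_{ℚ_{v₀}} → Γ_ℚ` of a completion `L_w` (`w ∣ 3`) of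
`L = ℚ(ζ_m)`, `m = cycLevel 3 0 r`, lands in the level `cycSubgroup 3 0 r`**: `L_w` contains the primitive
`m`-th root `ζ_m` (image of `IsCyclotomicExtension.zeta` under the injective `L → L_w`), so w2-acc5's
`absGaloisRestrictTower_mem_cycSubgroup` applies; the `ℚ_{v₀}`-algebra structure on `L_w` is the FLT
packet's, and `IsScalarTower ℚ ℚ_{v₀} L_w` holds because ring maps out of `ℚ` are unique.  Stated
with `E := v₀.adicCompletion ℚ` (`= Place.Completion (Sum.inr v₀)` by `rfl`), the currency of §2. [cite: Rubin2000, Ch. III §2.1] -/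
theorem absGaloisRestrictTower_adicCompletion_mem_cycSubgroup (r : Finset (HeightOneSpectrum (𝓞 ℚ)))
    (w : ((Rat.HeightOneSpectrum.primesEquiv (R := 𝓞 ℚ)).symm ⟨3, Fact.out⟩).Extension
      (𝓞 (CyclotomicField (cycLevel 3 0 r) ℚ)))
    (σ : absoluteGaloisGroup (w.1.adicCompletion (CyclotomicField (cycLevel 3 0 r) ℚ))) :
    absGaloisRestrictTower ℚ (((Rat.HeightOneSpectrum.primesEquiv (R := 𝓞 ℚ)).symm ⟨3, Fact.out⟩).adicCompletion ℚ)
      (w.1.adicCompletion (CyclotomicField (cycLevel 3 0 r) ℚ)) σ ∈ cycSubgroup 3 0 r := by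
  have hcomp : algebraMap ℚ (w.1.adicCompletion (CyclotomicField (cycLevel 3 0 r) ℚ)) =
      (algebraMap (((Rat.HeightOneSpectrum.primesEquiv (R := 𝓞 ℚ)).symm ⟨3, Fact.out⟩).adicCompletion ℚ) (w.1.adicCompletion (CyclotomicField (cycLevel 3 0 r) ℚ))).comp (algebraMap ℚ (((Rat.HeightOneSpectrum.primesEquiv (R := 𝓞 ℚ)).symm ⟨3, Fact.out⟩).adicCompletion ℚ)) :=
    Subsingleton.elim _ _
  haveI hST : IsScalarTower ℚ (((Rat.HeightOneSpectrum.primesEquiv (R := 𝓞 ℚ)).symm ⟨3, Fact.out⟩).adicCompletion ℚ) (w.1.adicCompletion (CyclotomicField (cycLevel 3 0 r) ℚ)) := IsScalarTower.of_algebraMap_eq' hcomp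
  have hζ := ((IsCyclotomicExtension.zeta_spec (cycLevel 3 0 r) ℚ
      (CyclotomicField (cycLevel 3 0 r) ℚ)).map_of_injective
    (algebraMap (CyclotomicField (cycLevel 3 0 r) ℚ)
      (w.1.adicCompletion (CyclotomicField (cycLevel 3 0 r) ℚ))).injective)
  exact absGaloisRestrictTower_mem_cycSubgroup 3 0 r _ _ hζ σ

/-! ### §2. `hKdef ⟹ hKloc`: the per-factor COMPAT implication from (DEF_w)/(RES_w)/(LAT_w) -/

/-- **The per-factor defined-Kato package `hKloc` (this seat's `fineKato_of_perFactorKatoPackage`) FROM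
`hKdef`** — `hKloc` with its per-factor COMPAT clause replaced by a displayed per-factor additive
`φ_w : H¹(Γ_{L_w}, T₃W|tower) →+ L_w` (the defined `exp*_w`) carrying (LAT_w) `range φ_w ⊆ Mʷ`, (RES_w)
`φ_w ∘ res_{L_w/ℚ_v} = e₃ ∘ φ` and (DEF_w) `Ψ(Λ_{0,r} y)_w = φ_w[ψT]` (Kato-v2's definition of `Λ` on
cocycles), at the fixed base place `v₀ = primesEquiv.symm 3` of `Ψ` (the `∀ v₃ ∋ 3` binder of `hKloc` is
discharged by `v₃ = v₀`).  Per factor the COMPAT implication is w2-acc5 g4's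
`exists_sub_eq_zsmul_apply_of_factorDef` (p496279) with `F := L_w`, `hU` := §1, `L_F := (Ψ ∘ Λ 0 r)_w`,
`e := algebraMap ∘ e₃ ∘ φ`; the rest is `hΨ`-bookkeeping.  `hKdef` displayed; closes nothing.
[cite: Kato2004Asterisque, §9.4 and Thm. 9.7 (pp. 188–189)]
[cite: Kim2022StructureSelmer, §3.4.1 and the proof of Thm. 3.13 (arXiv v3 pp. 26–27)]
[cite: BlochKato1990, §3 (Prop. 3.8, Ex. 3.11)] -/
theorem perFactorKatoPackage_of_perFactorDefined
    (hKdef : ∀ (W : WeierstrassCurve ℚ) [W.IsElliptic] [W.IsGloballyMinimal]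
      [ContinuousSMul ℤ_[3] (W.tateModule 3)] [Module.Free ℤ_[3] (W.tateModule 3)]
      [Module.Finite ℤ_[3] (W.tateModule 3)],
      (∀ m : ℕ, W.HasSurjectiveModNGaloisRep (3 ^ m : ℕ)) →
      (haveI : Fact (Nat.Prime 3) := ⟨Nat.prime_three⟩; Addv W 3) →
      ¬ 3 ∣ (W.baseChange ℚ_[3]).localTamagawaNumber ℤ_[3] →
      Nat.card {Q : (W.baseChange ℚ_[3]).toAffine.Point // (3 : ℕ) • Q = 0} = 1 →
      ∀ {N : ℕ} [NeZero N] (P : ModularParametrizationData W N), N = W.conductorNorm ℤ →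
        (∀ z ∈ P.L.lattice, ∃ w ∈ periodLattice P.f, z = P.c * w) →
        ¬ (3 : ℤ) ∣ P.maninConstant →
        ∃ (ι : (n : ℕ) → (CyclotomicField n ℚ →+* ℂ)) (κK : ℝ)
          (Λ : ∀ (k' : ℕ) (r : Finset (HeightOneSpectrum (𝓞 ℚ))),
            H1 (tateRep W 3) (cycSubgroup 3 k' r) →ₗ[ℤ_[3]]
              ℚ_[3] ⊗[ℚ] CyclotomicField (cycLevel 3 k' r) ℚ)
          (φ : (tateLocalRep W 3 (Sum.inr ((Rat.HeightOneSpectrum.primesEquiv (R := 𝓞 ℚ)).symm ⟨3, Fact.out⟩))).cohomology 1 →+ ℚ_[3]),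
          κK ≠ 0 ∧ (∃ u : ℚ, (u : ℝ) = κK ∧ padicValRat 3 u = 0) ∧
          (∀ y, φ y = 0 ↔ ∀ j : ℕ, tateLocalMap W 3 j (Sum.inr ((Rat.HeightOneSpectrum.primesEquiv (R := 𝓞 ℚ)).symm ⟨3, Fact.out⟩)) y ∈
            W.kummerSelmerStructure (((3 : ℕ) : ℤ) ^ j * ((3 : ℕ) : ℤ)) (Sum.inr ((Rat.HeightOneSpectrum.primesEquiv (R := 𝓞 ℚ)).symm ⟨3, Fact.out⟩))) ∧
          (∀ a : ℚ_[3], (∃ y, φ y = a) ↔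
            ∀ Q : (W.baseChange ℚ_[3]).toAffine.Point, ‖a * padicLog (W.baseChange ℚ_[3]) Q‖ ≤ 1) ∧
          (∀ (j : ℕ) (r : Finset (HeightOneSpectrum (𝓞 ℚ)))
            (Ψ : ℚ_[3] ⊗[ℚ] CyclotomicField (cycLevel 3 0 r) ℚ ≃ₐ[ℚ]
              (Π w : ((Rat.HeightOneSpectrum.primesEquiv (R := 𝓞 ℚ)).symm ⟨3, Fact.out⟩).Extension
                (𝓞 (CyclotomicField (cycLevel 3 0 r) ℚ)), w.1.adicCompletion (CyclotomicField (cycLevel 3 0 r) ℚ))),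
            (∀ (s : ℚ_[3]) (x : CyclotomicField (cycLevel 3 0 r) ℚ)
              (w : ((Rat.HeightOneSpectrum.primesEquiv (R := 𝓞 ℚ)).symm ⟨3, Fact.out⟩).Extension
                (𝓞 (CyclotomicField (cycLevel 3 0 r) ℚ))),
              Ψ (s ⊗ₜ[ℚ] x) w =
                algebraMap (CyclotomicField (cycLevel 3 0 r) ℚ) (w.1.adicCompletion (CyclotomicField (cycLevel 3 0 r) ℚ)) x *
                algebraMap (((Rat.HeightOneSpectrum.primesEquiv (R := 𝓞 ℚ)).symm ⟨3, Fact.out⟩).adicCompletion ℚ)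
                  (w.1.adicCompletion (CyclotomicField (cycLevel 3 0 r) ℚ)) (Padic.adicCompletionEquiv (𝓞 ℚ) ⟨3, Fact.out⟩ s)) →
            ∃ (Λ₀' M' : ∀ w : ((Rat.HeightOneSpectrum.primesEquiv (R := 𝓞 ℚ)).symm ⟨3, Fact.out⟩).Extension
                (𝓞 (CyclotomicField (cycLevel 3 0 r) ℚ)), Set (w.1.adicCompletion (CyclotomicField (cycLevel 3 0 r) ℚ)))
              (φ' : ∀ w : ((Rat.HeightOneSpectrum.primesEquiv (R := 𝓞 ℚ)).symm ⟨3, Fact.out⟩).Extension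
                (𝓞 (CyclotomicField (cycLevel 3 0 r) ℚ)),
                ((tateLocalRep W 3 (Sum.inr ((Rat.HeightOneSpectrum.primesEquiv (R := 𝓞 ℚ)).symm ⟨3, Fact.out⟩))).restrict
                  (absGaloisRestrict (((Rat.HeightOneSpectrum.primesEquiv (R := 𝓞 ℚ)).symm ⟨3, Fact.out⟩).adicCompletion ℚ)
                    (w.1.adicCompletion (CyclotomicField (cycLevel 3 0 r) ℚ)))).cohomology 1 →+ w.1.adicCompletion (CyclotomicField (cycLevel 3 0 r) ℚ)),
              (∀ w, Λ₀' w ⊆ w.1.adicCompletionIntegers (CyclotomicField (cycLevel 3 0 r) ℚ)) ∧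
              (∀ w, (0 : w.1.adicCompletion (CyclotomicField (cycLevel 3 0 r) ℚ)) ∈ Λ₀' w) ∧
              (∃ w₀, ∃ ℓ₀ ∈ Λ₀' w₀, ‖(Padic.adicCompletionEquiv (𝓞 ℚ) ⟨3, Fact.out⟩).symm
                (Algebra.trace (((Rat.HeightOneSpectrum.primesEquiv (R := 𝓞 ℚ)).symm ⟨3, Fact.out⟩).adicCompletion ℚ)
                  (w₀.1.adicCompletion (CyclotomicField (cycLevel 3 0 r) ℚ)) ℓ₀)‖ = 1) ∧
              (∀ w, ∀ μ ∈ M' w, ∀ ℓ ∈ Λ₀' w, ‖(Padic.adicCompletionEquiv (𝓞 ℚ) ⟨3, Fact.out⟩).symm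
                (Algebra.trace (((Rat.HeightOneSpectrum.primesEquiv (R := 𝓞 ℚ)).symm ⟨3, Fact.out⟩).adicCompletion ℚ)
                  (w.1.adicCompletion (CyclotomicField (cycLevel 3 0 r) ℚ)) (μ * ℓ))‖ ≤ 1) ∧
              (∀ w z, φ' w z ∈ M' w) ∧
              (∀ (w : ((Rat.HeightOneSpectrum.primesEquiv (R := 𝓞 ℚ)).symm ⟨3, Fact.out⟩).Extension
                (𝓞 (CyclotomicField (cycLevel 3 0 r) ℚ)))
                (h : (tateLocalRep W 3 (Sum.inr ((Rat.HeightOneSpectrum.primesEquiv (R := 𝓞 ℚ)).symm ⟨3, Fact.out⟩))).cohomology 1),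
                φ' w (ContinuousRep.cohomologyRes (tateLocalRep W 3 (Sum.inr ((Rat.HeightOneSpectrum.primesEquiv (R := 𝓞 ℚ)).symm ⟨3, Fact.out⟩)))
                    (absGaloisRestrict (((Rat.HeightOneSpectrum.primesEquiv (R := 𝓞 ℚ)).symm ⟨3, Fact.out⟩).adicCompletion ℚ)
                      (w.1.adicCompletion (CyclotomicField (cycLevel 3 0 r) ℚ))) 1 h) =
                  algebraMap (((Rat.HeightOneSpectrum.primesEquiv (R := 𝓞 ℚ)).symm ⟨3, Fact.out⟩).adicCompletion ℚ) (w.1.adicCompletion (CyclotomicField (cycLevel 3 0 r) ℚ))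
                    (Padic.adicCompletionEquiv (𝓞 ℚ) ⟨3, Fact.out⟩ (φ h))) ∧
              (∀ (w : ((Rat.HeightOneSpectrum.primesEquiv (R := 𝓞 ℚ)).symm ⟨3, Fact.out⟩).Extension
                (𝓞 (CyclotomicField (cycLevel 3 0 r) ℚ)))
                (φ'' : contOneCocycles (subgroupRep (tateRep W 3).toTopRep (cycSubgroup 3 0 r)))
                (ψT : contOneCocycles ((tateLocalRep W 3 (Sum.inr ((Rat.HeightOneSpectrum.primesEquiv (R := 𝓞 ℚ)).symm ⟨3, Fact.out⟩))).restrict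
                    (absGaloisRestrict (((Rat.HeightOneSpectrum.primesEquiv (R := 𝓞 ℚ)).symm ⟨3, Fact.out⟩).adicCompletion ℚ)
                      (w.1.adicCompletion (CyclotomicField (cycLevel 3 0 r) ℚ)))).toTopRep),
                  (∀ σ, ψT.1 σ = φ''.1 ⟨absGaloisRestrictTower ℚ
                      (((Rat.HeightOneSpectrum.primesEquiv (R := 𝓞 ℚ)).symm ⟨3, Fact.out⟩).adicCompletion ℚ) (w.1.adicCompletion (CyclotomicField (cycLevel 3 0 r) ℚ)) σ,
                    absGaloisRestrictTower_adicCompletion_mem_cycSubgroup r w σ⟩) →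
                  Ψ (Λ 0 r (oneCocycleClass _ φ'')) w = φ' w (oneCocycleClass _ ψT))) ∧
          ∀ (c d a : ℤ) (A : ℕ), 0 < A → Int.gcd c (6 * 3 * A) = 1 → Int.gcd d (6 * 3 * N) = 1 →
            ∃ (z : ∀ (k' : ℕ) (r : (cyclotomicLevelsRat 3 (badPlaces c d A N)).Ideals),
                  H1 (tateRep W 3) ((cyclotomicLevelsRat 3 (badPlaces c d A N)).level k' r.1))
              (x : ∀ (k' : ℕ) (r : (cyclotomicLevelsRat 3 (badPlaces c d A N)).Ideals),
                  CyclotomicField (cycLevel 3 k' r.1) ℚ),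
              ZetaBody W 3 P.f ι κK Λ c d a A z x) :
    ∀ (W : WeierstrassCurve ℚ) [W.IsElliptic] [W.IsGloballyMinimal]
      [ContinuousSMul ℤ_[3] (W.tateModule 3)] [Module.Free ℤ_[3] (W.tateModule 3)]
      [Module.Finite ℤ_[3] (W.tateModule 3)],
      (∀ m : ℕ, W.HasSurjectiveModNGaloisRep (3 ^ m : ℕ)) →
      (haveI : Fact (Nat.Prime 3) := ⟨Nat.prime_three⟩; Addv W 3) →
      ¬ 3 ∣ (W.baseChange ℚ_[3]).localTamagawaNumber ℤ_[3] →
      Nat.card {Q : (W.baseChange ℚ_[3]).toAffine.Point // (3 : ℕ) • Q = 0} = 1 →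
      ∀ (v₃ : HeightOneSpectrum (𝓞 ℚ)), ((3 : ℕ) : 𝓞 ℚ) ∈ v₃.asIdeal →
      ∀ {N : ℕ} [NeZero N] (P : ModularParametrizationData W N), N = W.conductorNorm ℤ →
        (∀ z ∈ P.L.lattice, ∃ w ∈ periodLattice P.f, z = P.c * w) →
        ¬ (3 : ℤ) ∣ P.maninConstant →
        ∃ (ι : (n : ℕ) → (CyclotomicField n ℚ →+* ℂ)) (κK : ℝ)
          (Λ : ∀ (k' : ℕ) (r : Finset (HeightOneSpectrum (𝓞 ℚ))),
            H1 (tateRep W 3) (cycSubgroup 3 k' r) →ₗ[ℤ_[3]]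
              ℚ_[3] ⊗[ℚ] CyclotomicField (cycLevel 3 k' r) ℚ)
          (φ : (tateLocalRep W 3 (Sum.inr v₃)).cohomology 1 →+ ℚ_[3]),
          κK ≠ 0 ∧ (∃ u : ℚ, (u : ℝ) = κK ∧ padicValRat 3 u = 0) ∧
          (∀ y, φ y = 0 ↔ ∀ j : ℕ, tateLocalMap W 3 j (Sum.inr v₃) y ∈
            W.kummerSelmerStructure (((3 : ℕ) : ℤ) ^ j * ((3 : ℕ) : ℤ)) (Sum.inr v₃)) ∧
          (∀ a : ℚ_[3], (∃ y, φ y = a) ↔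
            ∀ Q : (W.baseChange ℚ_[3]).toAffine.Point, ‖a * padicLog (W.baseChange ℚ_[3]) Q‖ ≤ 1) ∧
          (∀ (j : ℕ) (r : Finset (HeightOneSpectrum (𝓞 ℚ)))
            (Ψ : ℚ_[3] ⊗[ℚ] CyclotomicField (cycLevel 3 0 r) ℚ ≃ₐ[ℚ]
              (Π w : ((Rat.HeightOneSpectrum.primesEquiv (R := 𝓞 ℚ)).symm ⟨3, Fact.out⟩).Extension
                (𝓞 (CyclotomicField (cycLevel 3 0 r) ℚ)), w.1.adicCompletion (CyclotomicField (cycLevel 3 0 r) ℚ))),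
            (∀ (s : ℚ_[3]) (x : CyclotomicField (cycLevel 3 0 r) ℚ)
              (w : ((Rat.HeightOneSpectrum.primesEquiv (R := 𝓞 ℚ)).symm ⟨3, Fact.out⟩).Extension
                (𝓞 (CyclotomicField (cycLevel 3 0 r) ℚ))),
              Ψ (s ⊗ₜ[ℚ] x) w =
                algebraMap (CyclotomicField (cycLevel 3 0 r) ℚ) (w.1.adicCompletion (CyclotomicField (cycLevel 3 0 r) ℚ)) x *
                algebraMap (((Rat.HeightOneSpectrum.primesEquiv (R := 𝓞 ℚ)).symm ⟨3, Fact.out⟩).adicCompletion ℚ)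
                  (w.1.adicCompletion (CyclotomicField (cycLevel 3 0 r) ℚ)) (Padic.adicCompletionEquiv (𝓞 ℚ) ⟨3, Fact.out⟩ s)) →
            ∃ (Λ₀' M' : ∀ w : ((Rat.HeightOneSpectrum.primesEquiv (R := 𝓞 ℚ)).symm ⟨3, Fact.out⟩).Extension
                (𝓞 (CyclotomicField (cycLevel 3 0 r) ℚ)), Set (w.1.adicCompletion (CyclotomicField (cycLevel 3 0 r) ℚ))),
              (∀ w, Λ₀' w ⊆ w.1.adicCompletionIntegers (CyclotomicField (cycLevel 3 0 r) ℚ)) ∧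
              (∀ w, (0 : w.1.adicCompletion (CyclotomicField (cycLevel 3 0 r) ℚ)) ∈ Λ₀' w) ∧
              (∃ w₀, ∃ ℓ₀ ∈ Λ₀' w₀, ‖(Padic.adicCompletionEquiv (𝓞 ℚ) ⟨3, Fact.out⟩).symm
                (Algebra.trace (((Rat.HeightOneSpectrum.primesEquiv (R := 𝓞 ℚ)).symm ⟨3, Fact.out⟩).adicCompletion ℚ)
                  (w₀.1.adicCompletion (CyclotomicField (cycLevel 3 0 r) ℚ)) ℓ₀)‖ = 1) ∧
              (∀ w, ∀ μ ∈ M' w, ∀ ℓ ∈ Λ₀' w, ‖(Padic.adicCompletionEquiv (𝓞 ℚ) ⟨3, Fact.out⟩).symm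
                (Algebra.trace (((Rat.HeightOneSpectrum.primesEquiv (R := 𝓞 ℚ)).symm ⟨3, Fact.out⟩).adicCompletion ℚ)
                  (w.1.adicCompletion (CyclotomicField (cycLevel 3 0 r) ℚ)) (μ * ℓ))‖ ≤ 1) ∧
              ∀ (Ψ' : H1 (tateRep W 3) (cycSubgroup 3 0 r) →+
                  continuousCohomology 1 (subgroupRep
                    (W.torsionGaloisModule (((3 : ℕ) : ℤ) ^ j * ((3 : ℕ) : ℤ))).toTopRep (cycSubgroup 3 0 r))),
                (∀ (φ' : contOneCocycles (subgroupRep (tateRep W 3).toTopRep (cycSubgroup 3 0 r)))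
                    (ψ : contOneCocycles (subgroupRep
                      (W.torsionGaloisModule (((3 : ℕ) : ℤ) ^ j * ((3 : ℕ) : ℤ))).toTopRep (cycSubgroup 3 0 r))),
                    (∀ g, ((ψ.1 g : geomTorsion W (((3 : ℕ) : ℤ) ^ j * ((3 : ℕ) : ℤ))) : geomPoints W) =
                      TateModule.proj 3 (j + 1) (φ'.1 g)) →
                    Ψ' (oneCocycleClass _ φ') = oneCocycleClass _ ψ) →
                ∀ (y : H1 (tateRep W 3) (cycSubgroup 3 0 r))
                  (κ₀ : galoisCohomology (W.torsionGaloisModule (((3 : ℕ) : ℤ) ^ j * ((3 : ℕ) : ℤ))) 1)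
                  (h : (tateLocalRep W 3 (Sum.inr v₃)).cohomology 1),
                  resSubgroup (W.torsionGaloisModule (((3 : ℕ) : ℤ) ^ j * ((3 : ℕ) : ℤ))).toTopRep
                      (cycSubgroup 3 0 r) 1 κ₀ = Ψ' y →
                  galoisCohomology.localization (W.torsionGaloisModule (((3 : ℕ) : ℤ) ^ j * ((3 : ℕ) : ℤ)))
                      (Sum.inr v₃) 1 κ₀ = tateLocalMap W 3 j (Sum.inr v₃) h →
                  ∀ w, ∃ μ ∈ M' w,
                    Ψ ((φ h ⊗ₜ[ℚ] (1 : CyclotomicField (cycLevel 3 0 r) ℚ)) -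
                        (((3 : ℕ) : ℤ_[3]) ^ (0 : ℕ)) • Λ 0 r y) w =
                      (((3 : ℕ) : w.1.adicCompletion (CyclotomicField (cycLevel 3 0 r) ℚ)) ^ (j + 1)) * μ) ∧
          ∀ (c d a : ℤ) (A : ℕ), 0 < A → Int.gcd c (6 * 3 * A) = 1 → Int.gcd d (6 * 3 * N) = 1 →
            ∃ (z : ∀ (k' : ℕ) (r : (cyclotomicLevelsRat 3 (badPlaces c d A N)).Ideals),
                  H1 (tateRep W 3) ((cyclotomicLevelsRat 3 (badPlaces c d A N)).level k' r.1))
              (x : ∀ (k' : ℕ) (r : (cyclotomicLevelsRat 3 (badPlaces c d A N)).Ideals),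
                  CyclotomicField (cycLevel 3 k' r.1) ℚ),
              ZetaBody W 3 P.f ι κK Λ c d a A z x := by
  intro W _ _ _ _ _ htow hadd hc ht v₃ hv₃ N _ P hN hlat hman
  -- the row's place IS the base place of `Ψ`
  have hv₃eq : v₃ = ((Rat.HeightOneSpectrum.primesEquiv (R := 𝓞 ℚ)).symm ⟨3, Fact.out⟩) := by
    have h3 := primesEquiv_eq_of_natCast_mem Nat.prime_three hv₃
    have h3' : Rat.HeightOneSpectrum.primesEquiv (R := 𝓞 ℚ) v₃ = ⟨3, Fact.out⟩ := Subtype.ext h3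
    rw [← h3', Equiv.symm_apply_apply]
  subst hv₃eq
  obtain ⟨ι, κK, Λ, φ, hκ0, hκu, hker, hdual, hloc, hz⟩ := hKdef W htow hadd hc ht P hN hlat hman
  refine ⟨ι, κK, Λ, φ, hκ0, hκu, hker, hdual, fun j r Ψ hΨ => ?_, hz⟩
  obtain ⟨Λ₀', M', φ', hΛ₀', h0, hu', hM', hlat', hres', hdef'⟩ := hloc j r Ψ hΨ
  refine ⟨Λ₀', M', hΛ₀', h0, hu', hM', ?_⟩
  intro Ψ' hΨ' y κ₀ h hres hlocκ w
  -- `Place.Completion (Sum.inr v₀)` is `v₀.adicCompletion ℚ` by `rfl`: read the FLT packet's algebra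
  -- structure on it (w2-acc5's theorems are typed over `Place.Completion`)
  letI instEF : Algebra (NumberField.Place.Completion (K := ℚ) (Sum.inr ((Rat.HeightOneSpectrum.primesEquiv (R := 𝓞 ℚ)).symm ⟨3, Fact.out⟩)))
      (w.1.adicCompletion (CyclotomicField (cycLevel 3 0 r) ℚ)) :=
    inferInstanceAs (Algebra (((Rat.HeightOneSpectrum.primesEquiv (R := 𝓞 ℚ)).symm ⟨3, Fact.out⟩).adicCompletion ℚ) (w.1.adicCompletion (CyclotomicField (cycLevel 3 0 r) ℚ)))
  -- the `w`-component of `Λ_{0,r}` and the scalar `e₃ ∘ φ`, as additive maps into `L_w`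
  let LF : H1 (tateRep W 3) (cycSubgroup 3 0 r) →+ w.1.adicCompletion (CyclotomicField (cycLevel 3 0 r) ℚ) :=
    (Pi.evalAddMonoidHom (fun w : ((Rat.HeightOneSpectrum.primesEquiv (R := 𝓞 ℚ)).symm ⟨3, Fact.out⟩).Extension
        (𝓞 (CyclotomicField (cycLevel 3 0 r) ℚ)) => w.1.adicCompletion (CyclotomicField (cycLevel 3 0 r) ℚ)) w).comp
      (Ψ.toAddEquiv.toAddMonoidHom.comp (Λ 0 r).toAddMonoidHom)
  let e : (tateLocalRep W 3 (Sum.inr ((Rat.HeightOneSpectrum.primesEquiv (R := 𝓞 ℚ)).symm ⟨3, Fact.out⟩))).cohomology 1 →+ w.1.adicCompletion (CyclotomicField (cycLevel 3 0 r) ℚ) :=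
    ((algebraMap (((Rat.HeightOneSpectrum.primesEquiv (R := 𝓞 ℚ)).symm ⟨3, Fact.out⟩).adicCompletion ℚ) (w.1.adicCompletion (CyclotomicField (cycLevel 3 0 r) ℚ))).toAddMonoidHom.comp
      ((Padic.adicCompletionEquiv (𝓞 ℚ) ⟨3, Fact.out⟩).toRingEquiv.toAddMonoidHom)).comp φ
  have hLF : ∀ y, LF y = Ψ (Λ 0 r y) w := fun y => rfl
  have he : ∀ h, e h = algebraMap (((Rat.HeightOneSpectrum.primesEquiv (R := 𝓞 ℚ)).symm ⟨3, Fact.out⟩).adicCompletion ℚ) (w.1.adicCompletion (CyclotomicField (cycLevel 3 0 r) ℚ))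
      (Padic.adicCompletionEquiv (𝓞 ℚ) ⟨3, Fact.out⟩ (φ h)) := fun h => rfl
  -- w2-acc5 g4's per-factor Galois side, at `F := L_w` over the base place of `Ψ`
  -- (`Place.Completion (Sum.inr v₀)` is `v₀.adicCompletion ℚ` by `rfl`; the instance is the FLT packet's)
  obtain ⟨y', hy'⟩ := exists_sub_eq_zsmul_apply_of_factorDef W 3 j 0 r ((Rat.HeightOneSpectrum.primesEquiv (R := 𝓞 ℚ)).symm ⟨3, Fact.out⟩)
    (w.1.adicCompletion (CyclotomicField (cycLevel 3 0 r) ℚ)) (absGaloisRestrictTower_adicCompletion_mem_cycSubgroup r w) (φ' w) LF e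
    (fun y φ'' hφ'' ψT hψT => by subst hφ''; rw [hLF]; exact hdef' w φ'' ψT hψT)
    (fun h => by rw [he]; exact hres' w h) Ψ' hΨ' y κ₀ h hres hlocκ
  refine ⟨φ' w y', hlat' w y', ?_⟩
  -- bookkeeping: `Ψ(φ h ⊗ 1 − 3⁰•Λ y)_w = e h − LF y = 3^{j+1} • φ_w y'`
  rw [pow_zero, one_smul, map_sub, Pi.sub_apply, hΨ, map_one, one_mul, ← he, ← hLF, hy', zsmul_eq_mul,
    Int.cast_pow, Int.cast_natCast]
  rfl

end Summit.BirchSwinnertonDyer.BirchSwinnertonDyer.Theorems.KimAtThreeFineKatoPerFactorDefined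

end
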